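import Summits.ABC.IUTFork.LDHGenuinePerImagePrintInd1
import HarnessLib

/-!
# The fork at [IUTchIII] Corollary 3.12, L-DH level, READING (U) with the Θ-side computed over PRINT's (Ind1) strip part ⊔ PRINT's (Ind2):
# AT MOST the container reading (abc-iut cell, row «R17 = C:PERIMAGE-PRINT-IND1», (U)-twin of `LDHGenuinePerImagePrintInd1`; UNCONDITIONAL)

Record-only PROOF file (D-0012; no definition, no `Prop` fact) of the abc-iut cell (Cor. 3.12 sub-crew, seat abc-iut-c312-1 = holder of
record of the typed [IUTchIII] Thm. 3.11, gen 14). TAKES NO SIDE on [IUTchIII] Cor. 3.12.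

`LDHGenuinePerImagePrintInd1` (p516014) proved that a packet automorphism of a GENUINE tensor packet acting on pure tensors factorwise through
Dupuy–Hilado's single-place `Real.ismDH` — in particular through the subgroups generated by print's (Ind1) strip part and print's (Ind2) as
typed by this lineage — lies in the container `indTwo`, and drew the consequence for the cell's PER-IMAGE reading (P). THIS FILE draws the
same consequence for the UNION reading (U) — [IUTchIII] Cor. 3.12's own wording «the holomorphic hull of the union of the possible images»,
the cell's `negLogThetaAt` / `Cor312Of` (capsule permutations of (Ind1), then the (Ind2)-orbit, then the hull):
* **`localFields_lnνLp_hull_ismDH_slotUnion_le_negLogThetaAt`** — for the genuine real packet of a place section (any shell normalisation) and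
  ANY family `H` dominated factorwise by `Real.ismDH`: `ln ν̄_{𝕃_p}(v⃗ ↦ hull(⋃_{g ∈ H_{v⃗}} g(⋃_σ σ·O_𝕃(−P_Θ)))) ≤ −|log(Θ)|_p` (abc-iut-c312-d1's
  monotonicity in reading (U), `realPrimePacketWith_lnνLp_hull_orbitH_slotUnion_le_negLogThetaAt`, p503854, fed with R17a
  `localFields_le_indTwo_of_factorwise_ismDH`);
* **`ThetaVolumeInput.sum_lnνLp_hull_printInd1Ind2_slotUnion_le_negLogThetaNonarch`**, **`ThetaVolumeInput.cor312Of_of_union_printInd1Ind2`** —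
  the (U)-inequality with the Θ-side computed over ANY print-(Ind1)⊔(Ind2)-dominated `H` IMPLIES the cell's typed `Cor312Of I`;
* **`Cor22.ThetaVolumeDatumAt.not_union_printInd1Ind2_of_not_cor312Of`** — wherever the typed `Cor312Of` is refuted at a genuine datum, the
  print-(Ind1)⊔(Ind2) (U)-reading is refuted there too.
HONEST SCOPE: UPPER bound only (decides no cell where the container reading holds); c312-d1's zero-(Ind2)-gain identity for (U) over print's
(Ind2) (`localFields_lnνLp_hull_printInd2_slotUnion_eq`, p509534) does NOT extend to the strip part; statements about OUR typings; no side
taken on [IUTchIII] Cor. 3.12; NO abc claim. [cite: Mochizuki2012, IUTchIII Cor. 3.12 p. 173–174; Thm. 3.11 (i) p. 154]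
[cite: DupuyHilado2025, §4.7, §4.9, §4.11, §4.12] [claim: Mochizuki2012, status: disputed] for every IUT quotation. Axioms: standard three.
-/

noncomputable section

open Set Module NumberField IsDedekindDomain
open scoped Pointwise TensorProduct

namespace Summit.ABC.IUTFork

open Literature.IUT.LogVolume Literature.NumberTheory.NumberFields Thm311.Real

/-! ## 1. The GENUINE real packet of a place section: reading (U) over a `Real.ismDH`-dominated `H` ≤ the container reading -/

section GenuinePacket

variable {F₀ : Type} [Field F₀] [NumberField F₀] {K : Type} [Field K] [NumberField K] [Algebra F₀ K]
variable (σ : PlaceSection F₀ K) (p : ℕ) [hp : Fact p.Prime]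
variable (c : (j : ℕ) → (Fin (j + 1) → placesOver F₀ p) → ℚ_[p]) (hc0 : ∀ j e, c j e ≠ 0)
  (hcσ : ∀ (j : ℕ) (τ : Equiv.Perm (Fin (j + 1))) (e : Fin (j + 1) → placesOver F₀ p), c j (e ∘ τ) = c j e)

/-- **READING (U) OVER A `Real.ismDH`-DOMINATED `H` IS AT MOST THE CONTAINER READING `−|log(Θ)|_p`.** For the real packet of the genuine
completions of a place section (any shell normalisation `c`), a `p`-local Θ-idele `t`, and any family `H` of subgroups of the packet automorphisms
dominated factorwise by Dupuy–Hilado's `Real.ismDH (analyticLogv K)` (in particular by print's (Ind1) strip part ⊔ print's (Ind2)):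
`ln ν̄_{𝕃_p}(v⃗ ↦ hull(⋃_{g ∈ H_{v⃗}} g(⋃_σ σ·O_𝕃(−P_Θ)))) ≤ −|log(Θ)|_p` — c312-d1's (U)-monotonicity fed with R17a's `H ≤ indTwo`.
[cite: DupuyHilado2025, §4.7, §4.9, §4.11, §4.12] [cite: Mochizuki2012, IUTchIII Cor. 3.12 p. 174] [claim: Mochizuki2012, status: disputed] -/
theorem localFields_lnνLp_hull_ismDH_slotUnion_le_negLogThetaAt {lstar : ℕ}
    (t : Fin lstar → (v : placesOver F₀ p) → ((σ.localFields p).k v)ˣ)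
    (H : (j : ℕ) → (e : Fin (j + 1) → placesOver F₀ p) →
      Subgroup (PacketAlgebra p (fun b => (σ.localFields p).k (e b)) ≃ₗ[ℚ_[p]]
        PacketAlgebra p (fun b => (σ.localFields p).k (e b))))
    (hH : ∀ j e, ∀ g ∈ H j e,
      ∃ ψ : ∀ b : Fin (j + 1), Carrier (.inr (σ.lift (e b).1) : Thm311.Real.Place K) ≃ₗ[ℚ]
          Carrier (.inr (σ.lift (e b).1) : Thm311.Real.Place K),
        (∀ b, ψ b ∈ ismDH (analyticLogv K) (.inr (σ.lift (e b).1) : Thm311.Real.Place K)) ∧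
        ∀ x : ∀ b, (σ.localFields p).k (e b),
          (g : PacketAlgebra p (fun b => (σ.localFields p).k (e b)) ≃ₗ[ℚ_[p]]
              PacketAlgebra p (fun b => (σ.localFields p).k (e b))) (PiTensorProduct.tprod ℚ_[p] x) =
            PiTensorProduct.tprod ℚ_[p] (fun b =>
              RescaledCompletion.of K p (σ.lift (e b).1) (σ.natCast_mem_lift (e b))
                (ψ b ((RescaledCompletion.of K p (σ.lift (e b).1) (σ.natCast_mem_lift (e b))).symm (x b))))) :
    (realPrimePacketWith p (σ.localFields p) c hc0 hcσ).lnνLp lstar (fun j e =>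
        packetHull p (fun b => (σ.localFields p).k (e b))
          (⋃ g : H j e, (g : PacketAlgebra p (fun b => (σ.localFields p).k (e b)) ≃ₗ[ℚ_[p]]
              PacketAlgebra p (fun b => (σ.localFields p).k (e b))) ''
            ⋃ τ : Equiv.Perm (Fin (j + 1)), (realPrimePacketWith p (σ.localFields p) c hc0 hcσ).perm τ e ''
              (realPrimePacketWith p (σ.localFields p) c hc0 hcσ).pilotRegion t j (e ∘ τ))) ≤
      (realPrimePacketWith p (σ.localFields p) c hc0 hcσ).negLogThetaAt lstar t :=
  realPrimePacketWith_lnνLp_hull_orbitH_slotUnion_le_negLogThetaAt p (σ.localFields p) c hc0 hcσ t H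
    (localFields_le_indTwo_of_factorwise_ismDH σ p H hH)

end GenuinePacket

end Summit.ABC.IUTFork

/-! ## 2. Input level: the (U)-inequality over print's (Ind1)⊔(Ind2) IMPLIES the typed `Cor312Of` -/

namespace Literature.IUT.LogVolume

open Summit.ABC.IUTFork Summit.ABC.IUTFork.Thm311.Real Literature.NumberTheory.NumberFields

namespace ThetaVolumeInput

variable {F₀ : Type} [Field F₀] [NumberField F₀] {K : Type} [Field K] [NumberField K] [Algebra F₀ K]
variable (I : ThetaVolumeInput F₀ K)

/-- **`−|log(Θ)|^{nonarch}` in reading (U) COMPUTED OVER PRINT's (Ind1) STRIP PART ⊔ PRINT's (Ind2) IS AT MOST `negLogThetaNonarch I`.**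
For a genuine Θ-volume input `I` and ANY family `H = (H_{p,v⃗})` of subgroups of the packet automorphisms of the input's genuine packets
dominated factorwise by the subgroups generated by `Real.ind1Strip (analyticLogv K) v̲_b ∪ Real.ismIsm (analyticLogv K) v̲_b`:
`Σ_{p ∈ T(I)} ln ν̄_{𝕃_p}(v⃗ ↦ hull(⋃_{g ∈ H_{p,v⃗}} g(⋃_σ σ·O_𝕃(−P_Θ)))) ≤ negLogThetaNonarch I`.
[cite: Mochizuki2012, IUTchIII Thm. 3.11 (i) p. 154; Cor. 3.12 p. 174] [cite: DupuyHilado2025, §4.7, §4.9, §4.11, §4.12]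
[claim: Mochizuki2012, status: disputed] -/
theorem sum_lnνLp_hull_printInd1Ind2_slotUnion_le_negLogThetaNonarch
    (H : (p : ℕ) → (hp : p.Prime) → (j : ℕ) → (e : Fin (j + 1) → placesOver F₀ p) →
      haveI : Fact p.Prime := ⟨hp⟩
      Subgroup (PacketAlgebra p (fun b => (I.σ.localFields p).k (e b)) ≃ₗ[ℚ_[p]]
        PacketAlgebra p (fun b => (I.σ.localFields p).k (e b))))
    (hH : ∀ (p : ℕ) (hp : p.Prime), haveI : Fact p.Prime := ⟨hp⟩
      ∀ j e, ∀ g ∈ H p hp j e,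
        ∃ ψ : ∀ b : Fin (j + 1), Carrier (.inr (I.σ.lift (e b).1) : Thm311.Real.Place K) ≃ₗ[ℚ]
            Carrier (.inr (I.σ.lift (e b).1) : Thm311.Real.Place K),
          (∀ b, ψ b ∈ Subgroup.closure
            (ind1Strip (analyticLogv K) (I.σ.lift (e b).1) ∪ ismIsm (analyticLogv K) (I.σ.lift (e b).1))) ∧
          ∀ x : ∀ b, (I.σ.localFields p).k (e b),
            (g : PacketAlgebra p (fun b => (I.σ.localFields p).k (e b)) ≃ₗ[ℚ_[p]]
                PacketAlgebra p (fun b => (I.σ.localFields p).k (e b))) (PiTensorProduct.tprod ℚ_[p] x) =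
              PiTensorProduct.tprod ℚ_[p] (fun b =>
                RescaledCompletion.of K p (I.σ.lift (e b).1) (I.σ.natCast_mem_lift (e b))
                  (ψ b ((RescaledCompletion.of K p (I.σ.lift (e b).1) (I.σ.natCast_mem_lift (e b))).symm (x b))))) :
    (∑ p ∈ I.supportPrimes,
        if hp : p.Prime then
          (haveI : Fact p.Prime := ⟨hp⟩
           (I.packetAt p hp).lnνLp I.lstar (fun j e =>
             packetHull p (fun b => (I.σ.localFields p).k (e b))
               (⋃ g : H p hp j e, (g : PacketAlgebra p (fun b => (I.σ.localFields p).k (e b)) ≃ₗ[ℚ_[p]]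
                   PacketAlgebra p (fun b => (I.σ.localFields p).k (e b))) ''
                 ⋃ τ : Equiv.Perm (Fin (j + 1)), (I.packetAt p hp).perm τ e '' (I.packetAt p hp).pilotRegion (I.tΘ p hp) j (e ∘ τ))))
        else 0) ≤
      I.negLogThetaNonarch := by
  unfold negLogThetaNonarch
  refine Finset.sum_le_sum fun p hpT => ?_
  have hp : p.Prime := I.prime_of_mem_supportPrimes hpT
  rw [dif_pos hp, negLogThetaLoc_of_prime I hp]
  haveI : Fact p.Prime := ⟨hp⟩
  refine localFields_lnνLp_hull_ismDH_slotUnion_le_negLogThetaAt I.σ p (mScale p (I.σ.localFields p))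
    (mScale_ne_zero p (I.σ.localFields p)) (mScale_perm p (I.σ.localFields p)) (I.tΘ p hp) (H p hp) fun j e g hg => ?_
  obtain ⟨ψ, hψ, hgψ⟩ := hH p hp j e g hg
  exact ⟨ψ, fun b => mem_ismDH_of_mem_closure_ind1Strip_union_ismIsm (analyticLogv K) _ (hψ b), hgψ⟩

/-- **The (U)-inequality with the Θ-side over PRINT's (Ind1)⊔(Ind2) IMPLIES the cell's typed `Cor312Of I`** (Θ-side over the full Dupuy–Hilado
container): IF `−|log(q)| ≤ [−|log(Θ)|^{nonarch} in reading (U) over a print-(Ind1)⊔(Ind2)-dominated H] + ((l+5)/4)·log π` (HYPOTHESIS, inline),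
THEN `Cor312Of I`. Pure bookkeeping (monotonicity); it discharges nothing; no side taken.
[cite: Mochizuki2012, IUTchIII Cor. 3.12 p. 173–174] [cite: DupuyHilado2025, §4.11, §4.12] [claim: Mochizuki2012, status: disputed] -/
theorem cor312Of_of_union_printInd1Ind2
    (H : (p : ℕ) → (hp : p.Prime) → (j : ℕ) → (e : Fin (j + 1) → placesOver F₀ p) →
      haveI : Fact p.Prime := ⟨hp⟩
      Subgroup (PacketAlgebra p (fun b => (I.σ.localFields p).k (e b)) ≃ₗ[ℚ_[p]]
        PacketAlgebra p (fun b => (I.σ.localFields p).k (e b))))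
    (hH : ∀ (p : ℕ) (hp : p.Prime), haveI : Fact p.Prime := ⟨hp⟩
      ∀ j e, ∀ g ∈ H p hp j e,
        ∃ ψ : ∀ b : Fin (j + 1), Carrier (.inr (I.σ.lift (e b).1) : Thm311.Real.Place K) ≃ₗ[ℚ]
            Carrier (.inr (I.σ.lift (e b).1) : Thm311.Real.Place K),
          (∀ b, ψ b ∈ Subgroup.closure
            (ind1Strip (analyticLogv K) (I.σ.lift (e b).1) ∪ ismIsm (analyticLogv K) (I.σ.lift (e b).1))) ∧
          ∀ x : ∀ b, (I.σ.localFields p).k (e b),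
            (g : PacketAlgebra p (fun b => (I.σ.localFields p).k (e b)) ≃ₗ[ℚ_[p]]
                PacketAlgebra p (fun b => (I.σ.localFields p).k (e b))) (PiTensorProduct.tprod ℚ_[p] x) =
              PiTensorProduct.tprod ℚ_[p] (fun b =>
                RescaledCompletion.of K p (I.σ.lift (e b).1) (I.σ.natCast_mem_lift (e b))
                  (ψ b ((RescaledCompletion.of K p (I.σ.lift (e b).1) (I.σ.natCast_mem_lift (e b))).symm (x b)))))
    (h : I.negAbsLogQ ≤
      (∑ p ∈ I.supportPrimes,
        if hp : p.Prime then
          (haveI : Fact p.Prime := ⟨hp⟩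
           (I.packetAt p hp).lnνLp I.lstar (fun j e =>
             packetHull p (fun b => (I.σ.localFields p).k (e b))
               (⋃ g : H p hp j e, (g : PacketAlgebra p (fun b => (I.σ.localFields p).k (e b)) ≃ₗ[ℚ_[p]]
                   PacketAlgebra p (fun b => (I.σ.localFields p).k (e b))) ''
                 ⋃ τ : Equiv.Perm (Fin (j + 1)), (I.packetAt p hp).perm τ e '' (I.packetAt p hp).pilotRegion (I.tΘ p hp) j (e ∘ τ))))
        else 0) + archLogTheta I.l) :
    I.Cor312Of := by
  have hle := I.sum_lnνLp_hull_printInd1Ind2_slotUnion_le_negLogThetaNonarch H hH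
  unfold Cor312Of negLogTheta
  linarith

end ThetaVolumeInput

/-! ## 3. Datum level: every refuted-as-typed (U) cell is refuted for print's (Ind1)⊔(Ind2) reading too -/

namespace Cor22

namespace ThetaVolumeDatumAt

open Literature.NumberTheory.DiophantineGeometry.GenEll

variable {P : NFPoint} {l : ℕ} (T : ThetaVolumeDatumAt P l)

/-- **WHERE THE TYPED `Cor312Of` IS REFUTED, THE PRINT-(Ind1)⊔(Ind2) (U)-READING IS REFUTED.** At a genuine Θ-volume datum `T` of a point `(P, l)`
with `¬ T.Cor312Of`, for EVERY family `H` of subgroups of the packet automorphisms of `T`'s genuine packets dominated factorwise by the subgroups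
generated by print's (Ind1) strip part ∪ print's (Ind2): `¬ ( −|log(q)| ≤ Σ_p ln ν̄_{𝕃_p}(hull of the H-orbit of ⋃_σ σ·O_𝕃(−P_Θ)) + ((l+5)/4)·log π )`.
READING (about OUR typings): upper bound / transfer only; no side taken. [cite: Mochizuki2012, IUTchIII Cor. 3.12 p. 173–174; Thm. 3.11 (i) p. 154]
[cite: DupuyHilado2025, §4.11, §4.12] [claim: Mochizuki2012, status: disputed] -/
theorem not_union_printInd1Ind2_of_not_cor312Of (hT : ¬ T.Cor312Of) :
    letI := T.instFieldF; letI := T.instNumberFieldF; letI := T.instFieldK; letI := T.instNumberFieldK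
    letI := T.instAlgebraK; letI := T.instIsElliptic
    ∀ (H : (p : ℕ) → (hp : p.Prime) → (j : ℕ) →
        (e : Fin (j + 1) → placesOver (Literature.IUT.HodgeTheaters.fieldOfModuli T.E) p) →
        haveI : Fact p.Prime := ⟨hp⟩
        Subgroup (PacketAlgebra p (fun b => (T.I.σ.localFields p).k (e b)) ≃ₗ[ℚ_[p]]
          PacketAlgebra p (fun b => (T.I.σ.localFields p).k (e b)))),
      (∀ (p : ℕ) (hp : p.Prime), haveI : Fact p.Prime := ⟨hp⟩
        ∀ j e, ∀ g ∈ H p hp j e,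
          ∃ ψ : ∀ b : Fin (j + 1), Carrier (.inr (T.I.σ.lift (e b).1) : Thm311.Real.Place T.K) ≃ₗ[ℚ]
              Carrier (.inr (T.I.σ.lift (e b).1) : Thm311.Real.Place T.K),
            (∀ b, ψ b ∈ Subgroup.closure
              (ind1Strip (analyticLogv T.K) (T.I.σ.lift (e b).1) ∪ ismIsm (analyticLogv T.K) (T.I.σ.lift (e b).1))) ∧
            ∀ x : ∀ b, (T.I.σ.localFields p).k (e b),
              (g : PacketAlgebra p (fun b => (T.I.σ.localFields p).k (e b)) ≃ₗ[ℚ_[p]]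
                  PacketAlgebra p (fun b => (T.I.σ.localFields p).k (e b))) (PiTensorProduct.tprod ℚ_[p] x) =
                PiTensorProduct.tprod ℚ_[p] (fun b =>
                  RescaledCompletion.of T.K p (T.I.σ.lift (e b).1) (T.I.σ.natCast_mem_lift (e b))
                    (ψ b ((RescaledCompletion.of T.K p (T.I.σ.lift (e b).1) (T.I.σ.natCast_mem_lift (e b))).symm (x b))))) →
      ¬ (T.negAbsLogQ ≤
          (∑ p ∈ T.I.supportPrimes,
            if hp : p.Prime then
              (haveI : Fact p.Prime := ⟨hp⟩
               (T.I.packetAt p hp).lnνLp T.I.lstar (fun j e =>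
                 packetHull p (fun b => (T.I.σ.localFields p).k (e b))
                   (⋃ g : H p hp j e, (g : PacketAlgebra p (fun b => (T.I.σ.localFields p).k (e b)) ≃ₗ[ℚ_[p]]
                       PacketAlgebra p (fun b => (T.I.σ.localFields p).k (e b))) ''
                     ⋃ τ : Equiv.Perm (Fin (j + 1)), (T.I.packetAt p hp).perm τ e ''
                       (T.I.packetAt p hp).pilotRegion (T.I.tΘ p hp) j (e ∘ τ))))
            else 0) + ThetaVolumeInput.archLogTheta l) := by
  letI := T.instFieldF; letI := T.instNumberFieldF; letI := T.instFieldK; letI := T.instNumberFieldK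
  letI := T.instAlgebraK; letI := T.instIsElliptic
  intro H hH h
  have hl' : ThetaVolumeInput.archLogTheta T.I.l = ThetaVolumeInput.archLogTheta l := by rw [T.l_eq]
  rw [← hl'] at h
  exact hT (T.I.cor312Of_of_union_printInd1Ind2 H hH h)

end ThetaVolumeDatumAt

end Cor22

end Literature.IUT.LogVolume

end
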